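import Summits.ABC.IUTFork.Repair.CandMochizuki7RamEIsoPins
import Summits.ABC.IUTFork.Repair.CandMochizuki7RamEPins
import Summits.ABC.IUTFork.Cor312NaiveThm311
import HarnessLib

/-!
# IUT REPAIR BRANCH (rung LADDER-ABC:A2.RP) — the ramified bed RAM_{e;G₁,G₂}(p, m) carries the TYPED [IUTchIII] Theorem 3.11 (i)–(iii) for
# EVERY reading of Ism; under the isometric readings it is a THREE-PINNED, Thm-3.11-TYPED countermodel to `GapH3` at every index `e` and depth `m ≥ 1`

Record file (D-0012; MODEL DATA `ramDegreesF`/`ramSituationF`/`ramFullF`/`ramSettingF` — the reading-generic ramified bed with honest (b), honest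
column, HONEST GLOBAL REALIFIED FROBENIOIDS (objects `π^k𝒪_L ↦` region `box k`, degree `μ(box k) = −(k/e)·log p`) and abc-iut-w4-d026's link
data `NaiveWitness.naiveLink` —, then proof-only cells; no `Prop` fact; adjudication-closure files IMPORTED, not edited) of the abc-iut cell, seat
abc-iut-rp-m1 (gen 5; class (ii)). TAKES NO SIDE on [IUTchIII] Cor. 3.12 or on any author; typed ≠ proved. Sequel to `Repair/CandMochizuki7RamEIsoPins`
(PINS DICHOTOMY: under the isometric readings `1 ∈ G₁, G₂ ⊆ isoKE` the valuation-box reading `valRegion` satisfies `PinnedRegions3` and every pinned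
reading violates the residual; under the Dupuy–Hilado reading the Θ-pin is unsatisfiable, `Repair/CandMochizuki7RamEPins`).

WHY. The director's tests T-b/T-c (2026-08-26T05:11:35Z) and the adjudication's ∀-form countermodel (`PinnedHonest.not_gapA''_of_scaledAt`,
`Cor312PinnedRegionsHonest`) are phrased over «typed Thm 3.11 (i)–(iii) ∧ PinnedRegions3». Gen 3/4/5's ramified beds so far carried Thm. 3.11
(ii) (b) only. KERNEL CELLS (every prime `p`, every `e ≥ 1`, every `m`):
* **`ramFullF_statement` — the typed [IUTchIII] Theorem 3.11 (i) ∧ (ii) ∧ (iii) (`FullSituation.Statement`) HOLDS on RAM_{e;G₁,G₂}^F(p, m) for EVERY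
  reading `1 ∈ G₁, G₂`** (any sets of automorphisms of `ℚ^e` containing the identity — the Dupuy–Hilado `GL(I)` and the isometric `isoKE` alike):
  (i) the honest tuple lies in the sub-packets (one-point fibres), the degree of `π^k𝒪_L` IS the log-volume of `box k`, the classes `^{n,∘}ℜ^LGP`
  coincide (bi-coric data constant in `n`); (ii) KummerA/B/C by `rfl`, (Ind3) `unitImage ⊆ shellPk`; (iii) as in w4-d026's naive model
  (full poly-isomorphisms, abelian `ℤˣ`-equivariance);
* **`isoF_pinned_countermodel` — under every ISOMETRIC reading, `m ≥ 1`: typed Thm 3.11 ∧ BridgeHyps ∧ `|log(q)| > 0` ∧ `PinnedRegions3 valRegion`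
  ∧ ¬`PilotKummerIndRelated` ∧ ¬`PilotKummerCompat` ∧ ¬Statement ∧ ¬Licence ∧ ¬`GapH3` ∧ ¬`GapA3`** — the exact shape of abc-iut-w5-d230's unramified
  `pinned_countermodel` / `Cor312PinnedRegionsHonest`, now at EVERY ramification index and depth; `not_pilotKummerIndRelated_of_pinnedF` is its
  ∀-ρ form (every region reading satisfying the two region pins violates the OBJECT sentence);
* `dhF_typed_windows` — under the Dupuy–Hilado reading (`Gᵢ = GL(I)`) typed Thm 3.11 holds TOO, with gen 4's windows (Statement for `m ≤ e−1`) and NO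
  region reading three-pinning the bed (`CandMochizuki7RamEPins`).
READING (neutral): the typed Theorem 3.11 does not separate the two readings of Ism on the ramified toy — both satisfy it verbatim —; what separates them
is the Corollary's own Θ-pin (hρ), satisfiable exactly on the isometric side, where the bed is a typed, three-pinned countermodel at every `(e, m ≥ 1)`.
Toy (`l⋇ = 2`, one place); no repair claimed; nothing here bears on [IUTchIII] Cor. 3.12. [claim: Mochizuki2012, status: disputed]
[cite: ScholzeStix2018, §2.2 pp. 9–10] [cite: DupuyHilado2025, §4.9]
-/

noncomputable section

open Set

namespace Summit.ABC.IUTFork.Repair.CandMochizuki7RamE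

open Thm311 Cor312 Cor312.Checks Cor312.IdentifiedNonVacuity Cor312Vol Cor312Vol.NaiveWitness Cor312Vol.PinnedWitness
  Cor312Vol.RamifiedEWitness Literature.IUT.LogThetaLattice
open Cor312Vol.RamifiedWitness (PLe IsPInt ple_zero isPInt_one fib eq_fib ple_ppow_iff)

variable (p e : ℕ) (G₁ G₂ : Set ((Fin e → ℚ) ≃ₗ[ℚ] (Fin e → ℚ)))
  (h₁ : LinearEquiv.refl ℚ (Fin e → ℚ) ∈ G₁) (h₂ : LinearEquiv.refl ℚ (Fin e → ℚ) ∈ G₂) [NeZero e] [hp : Fact p.Prime] (m : ℕ)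

/-! ## 1. The bed with honest global realified Frobenioids and link data -/

/-- **(c)'s global realified Frobenioids, HONEST**: objects the fractional ideals `π^k𝒪_L` (`k ∈ ℤ`; Frobenius-like and étale-like copies identified by the
identity), region the polydisc `box k`, degree its log-volume `−(k/e)·log p`. [claim: Mochizuki2012, status: disputed] -/
def ramDegreesF (j : toyIndex.LabelStar) : GlobalDegrees (ramShellsWith p e G₁ G₂ h₁ h₂) j where
  ObjMOD := ℤ
  Objmod := ℤ
  natIso := Equiv.refl ℤ
  deg := fun k => -((k : ℝ) / e) * Real.log p
  region := fun k vQ => box p e j.1 vQ k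

/-- The situation: the reading's shells, honest (b) (`ramDataWithH`), honest degrees. [claim: Mochizuki2012, status: disputed] -/
def ramSituationF : Situation toyIndex where
  L := ramShellsWith p e G₁ G₂ h₁ h₂
  D := fun _ => ramDataWithH p e G₁ G₂ h₁ h₂ m
  G := fun _ j => ramDegreesF p e G₁ G₂ h₁ h₂ j

/-- **The FULL situation of [IUTchIII] Thm. 3.11 on the ramified bed of the reading `(G₁, G₂)`**: honest column `ramColumnWith`, link data the
naive model's (abc-iut-w4-d026's `naiveLink`: full poly-isomorphisms between one-object groupoids with automorphism group `ℤˣ`).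
[claim: Mochizuki2012, status: disputed] -/
def ramFullF : FullSituation toyIndex where
  toSituation := ramSituationF p e G₁ G₂ h₁ h₂ m
  col := fun _ => ramColumnWith p e G₁ G₂ h₁ h₂ m
  link := NaiveWitness.naiveLink

/-- **The Cor. 3.12 setting over the full situation** (verbatim the glue of `ramSettingWithH`). [claim: Mochizuki2012, status: disputed] -/
def ramSettingF : Cor312.Setting (ramFullF p e G₁ G₂ h₁ h₂ m).toLatticeSituation.toSituation where
  n := 0
  HT := ℤ × ℤ
  LogLink := fun _ _ => Unit
  IsFull := fun _ => True
  lattice :=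
    { theater := fun n m => (n, m)
      distinct := fun p q h => by simpa using h
      logLink := fun _ _ => ()
      logLink_full := fun _ _ => trivial }
  Frd := Unit
  IsoF := fun _ _ => Unit
  Ob := fun _ => ℤ
  realify := id
  Strip := Unit
  IsoS := fun _ _ => Unit
  M := fun _ _ => ExpMonoid
  sig := pinSig
  split := { Msplit := fun _ _ => ⊤, exists_gen := fun _ _ => ⟨⟨gen, trivial⟩, top_gen_isGenerator⟩ }
  ObΔ := ℤ
  N := fun _ _ => ExpMonoid
  qData :=
    { q := fun _ _ => gen
      q_gen := fun _ _ => gen_isGenerator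
      objOf := fun x => (expOf (x () (Set.mem_univ ())) : ℤ) }
  frame := fun j vQ => rFrame p e j vQ
  hul_adm := fun j vQ _ hH => by obtain ⟨k, rfl⟩ := hH; exact rFrame_bounded_hasHull j vQ k
  thetaRegionOf := fun _ k j vQ => box p e j vQ ((m : ℤ) * k * jsq j)
  qRegionOf := fun k j vQ => box p e j vQ (if j = 0 then 0 else (m : ℤ) * k)
  qRegion_mem := fun j vQ => ⟨_, rfl⟩
  qSupport_finite := fun _ => Set.toFinite _

/-! ## 2. The typed Theorem 3.11 (i) ∧ (ii) ∧ (iii) holds, for every reading -/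

omit [NeZero e] hp in
/-- Over the one-place index the sub-packet `log(^{S^±_{j+1},j}D⊢_v)` is the whole packet (every pure tensor qualifies). [folklore] -/
theorem subPacket_ramShellsWith_eq_top (j : toyIndex.Label) (v : toyIndex.V) : (ramShellsWith p e G₁ G₂ h₁ h₂).SubPacket j v = ⊤ := by
  haveI : Subsingleton toyIndex.V := inferInstanceAs (Subsingleton Unit)
  refine top_unique fun x _ => ?_
  have hx : x ∈ Submodule.span ℚ (Set.range (PiTensorProduct.tprod ℚ
      (s := fun _ : toyIndex.Caps j => (ramShellsWith p e G₁ G₂ h₁ h₂).Packet1 (toyIndex.over v)))) := by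
    rw [PiTensorProduct.span_tprod_eq_top]; trivial
  refine Submodule.span_mono ?_ hx
  rintro _ ⟨y, rfl⟩
  exact ⟨y, fun w hw => absurd (Subsingleton.elim _ _) hw, rfl⟩

/-- The log-volume of a region that is a polydisc: `μ(hull(box k)) = −(k/e)·log p`. [folklore] -/
theorem rVol_hull_box (j : toyIndex.Label) (vQ : toyIndex.VQ) (k : ℤ) :
    rVol p e j vQ ((rFrame p e j vQ).hull (box p e j vQ k)) = -((k : ℝ) / e) * Real.log p := by
  rw [rFrame_hull_box, rVol_box]

/-- **(i)**: the honest tuple lies in the sub-packets; the degree of `π^k𝒪_L` IS the log-volume of `box k`; the classes `^{n,∘}ℜ^LGP` coincide.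
[folklore] -/
theorem ramFullF_partI : (ramFullF p e G₁ G₂ h₁ h₂ m).PartI := by
  refine ⟨fun n v hv x _ j => ?_, fun n j k => ⟨fun vQ => rFrame_bounded_hasHull j.1 vQ k, Set.toFinite _, ?_⟩, fun _ _ => rfl⟩
  · show x j ∈ (ramShellsWith p e G₁ G₂ h₁ h₂).SubPacket j.1 v
    rw [subPacket_ramShellsWith_eq_top]; trivial
  · rw [finsum_unique]
    exact (rVol_hull_box p e j.1 _ k).symm

/-- **(ii)**, column by column: KummerA (same admissibility and log-volume), KummerB/KummerC by `rfl`, (Ind3) (`unitImage = shellPk`, no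
archimedean place). [folklore] -/
theorem ramFullF_partII : (ramFullF p e G₁ G₂ h₁ h₂ m).toLatticeSituation.PartII := by
  intro n
  refine (Column.partII_iff _ _).2 ⟨fun m' j vQ A hA => ⟨hA, rfl⟩, fun _ _ _ => rfl, fun _ _ => rfl, ?_⟩
  exact ⟨fun m' m'' j vQ _ => subset_rfl, fun m' j vQ h => absurd trivial h⟩

/-- **(iii)**: as in the naive model (full poly-isomorphisms; abelian `ℤˣ`-equivariance of the Kummer isomorphism `(−1)^m`). [folklore] -/
theorem ramFullF_partIII : (ramFullF p e G₁ G₂ h₁ h₂ m).PartIII := by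
  refine ⟨NaiveWitness.naiveLink.partIIIa_holds, NaiveWitness.naiveLink.partIIIb_holds, ?_, ?_,
    (ramFullF p e G₁ G₂ h₁ h₂ m).evalCompatUpToInd_of_multiradialCompat fun _ _ => rfl⟩
  · refine NaiveWitness.naiveLink.partIIIc_of_full (fun _ => rfl) fun n m' => ?_
    rintro _ ⟨a, rfl⟩
    show NaiveWitness.unitIso a ≪≫ NaiveWitness.unitIso ((-1) ^ m'.natAbs) =
      NaiveWitness.unitIso ((-1) ^ m'.natAbs) ≪≫ NaiveWitness.unitIso a
    rw [NaiveWitness.unitIso_trans, NaiveWitness.unitIso_trans, mul_comm]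
  · intro n m'; exact Thm311.PolyIsoCalc.stabilized_full _ _

/-- **THE TYPED [IUTchIII] THEOREM 3.11 (i) ∧ (ii) ∧ (iii) HOLDS on RAM_{e;G₁,G₂}^F(p, m), for EVERY reading `1 ∈ G₁, G₂`.**
[claim: Mochizuki2012, status: disputed] -/
theorem ramFullF_statement : (ramFullF p e G₁ G₂ h₁ h₂ m).Statement :=
  ⟨ramFullF_partI p e G₁ G₂ h₁ h₂ m, ramFullF_partII p e G₁ G₂ h₁ h₂ m, ramFullF_partIII p e G₁ G₂ h₁ h₂ m⟩

/-! ## 3. The cells of the prequels, read on the full bed (the glue, the shells and the column are the same terms) -/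

/-- Thm. 3.11 (ii) (b) for the setting's column. [folklore] -/
theorem kummerB_ramF :
    ((ramFullF p e G₁ G₂ h₁ h₂ m).col (ramSettingF p e G₁ G₂ h₁ h₂ m).n).KummerB ((ramFullF p e G₁ G₂ h₁ h₂ m).D (ramSettingF p e G₁ G₂ h₁ h₂ m).n) :=
  fun _ _ _ => rfl

/-- The bridge hypotheses and `|log(q)| > 0` (gen 4's reading-generic lemmas, field by field; readings inside `GL(I)`). [folklore] -/
theorem ramSettingF_bridgeHyps_absLogQPos (hG₁' : G₁ ⊆ latticeAuts p e) (hG₂' : G₂ ⊆ latticeAuts p e) (hm : 1 ≤ m) :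
    BridgeHyps (ramSettingF p e G₁ G₂ h₁ h₂ m) ∧ (ramSettingF p e G₁ G₂ h₁ h₂ m).AbsLogQPos :=
  have h := ramSettingWith_bridgeHyps p e h₁ h₂ m hG₁' hG₂'
  ⟨{ mono := h.mono, image_adm := h.image_adm, image_fin := h.image_fin, hul_nonempty := h.hul_nonempty,
      theta_nonempty := h.theta_nonempty, finite := h.finite }, ramSettingWith_absLogQPos p e h₁ h₂ m hm⟩

section Iso

variable {G₁ G₂} (hG₁ : G₁ ⊆ isoKE p e) (hG₂ : G₂ ⊆ isoKE p e)

include hG₁ hG₂ in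
/-- **`PinnedRegions3` HOLDS on the full bed** for `(valRegion, {(π^m)_j})` under every isometric reading (the prequel's three pins, same terms).
[claim: Mochizuki2012, status: disputed] -/
theorem pinnedRegions3_valRegionF :
    PinnedRegions3 (ramFullF p e G₁ G₂ h₁ h₂ m).toLatticeSituation (ramSettingF p e G₁ G₂ h₁ h₂ m) (valRegion p e) (qDatumE p e m) :=
  pinnedRegions3_valRegion p e h₁ h₂ m hG₁ hG₂

include hG₁ hG₂ in
/-- **∀-ρ form: every region reading satisfying the two region pins with the honest q-datum violates the OBJECT sentence** (`m ≥ 1`).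
[claim: Mochizuki2012, status: disputed] -/
theorem not_pilotKummerIndRelated_of_pinnedF (hm : 1 ≤ m)
    (ρ : (∀ v : toyIndex.V, v ∈ toyIndex.Vbad → Set ((ramShellsE p e).StarPacket v)) →
      ∀ (j : toyIndex.Label) (vQ : toyIndex.VQ), Set ((ramShellsE p e).Packet j vQ))
    (hpin : PinnedRegions (ramFullF p e G₁ G₂ h₁ h₂ m).toLatticeSituation (ramSettingF p e G₁ G₂ h₁ h₂ m) ρ (qDatumE p e m)) :
    ¬ PilotKummerIndRelated (ramFullF p e G₁ G₂ h₁ h₂ m).toLatticeSituation (ramSettingF p e G₁ G₂ h₁ h₂ m) ρ (qDatumE p e m) :=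
  not_pilotKummerIndRelated_of_pinned_isometric p e h₁ h₂ m hG₁ hG₂ hm ρ hpin

include hG₁ hG₂ in
/-- **THE THREE-PINNED, Thm-3.11-TYPED COUNTERMODEL AT EVERY RAMIFICATION INDEX AND DEPTH** (every isometric reading `1 ∈ G₁, G₂ ⊆ isoKE`, every
prime `p`, every `e ≥ 1`, every `m ≥ 1`): the typed Theorem 3.11 (i)–(iii), the bridge hypotheses, `|log(q)| > 0` and `PinnedRegions3` (valuation-box
reading, honest q-datum) all HOLD — and the OBJECT sentence `PilotKummerIndRelated`, its inline form `PilotKummerCompat`, the typed Corollary 3.12,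
the licence (xi-f), `GapH3` and `GapA3` all FAIL. [claim: Mochizuki2012, status: disputed] -/
theorem isoF_pinned_countermodel (hm : 1 ≤ m) :
    (ramFullF p e G₁ G₂ h₁ h₂ m).Statement ∧
      BridgeHyps (ramSettingF p e G₁ G₂ h₁ h₂ m) ∧ (ramSettingF p e G₁ G₂ h₁ h₂ m).AbsLogQPos ∧
      PinnedRegions3 (ramFullF p e G₁ G₂ h₁ h₂ m).toLatticeSituation (ramSettingF p e G₁ G₂ h₁ h₂ m) (valRegion p e) (qDatumE p e m) ∧
      ¬ PilotKummerIndRelated (ramFullF p e G₁ G₂ h₁ h₂ m).toLatticeSituation (ramSettingF p e G₁ G₂ h₁ h₂ m) (valRegion p e) (qDatumE p e m) ∧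
      ¬ PilotKummerCompat (ramFullF p e G₁ G₂ h₁ h₂ m).toLatticeSituation (ramSettingF p e G₁ G₂ h₁ h₂ m) (qDatumE p e m) ∧
      ¬ (ramSettingF p e G₁ G₂ h₁ h₂ m).Statement ∧ ¬ Thm311ToCor312.Licence (ramSettingF p e G₁ G₂ h₁ h₂ m) ∧
      ¬ GapH3 (ramFullF p e G₁ G₂ h₁ h₂ m).toLatticeSituation (ramSettingF p e G₁ G₂ h₁ h₂ m) (valRegion p e) (qDatumE p e m) ∧
      ¬ GapA3 (ramFullF p e G₁ G₂ h₁ h₂ m).toLatticeSituation (ramSettingF p e G₁ G₂ h₁ h₂ m) (valRegion p e) (qDatumE p e m) :=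
  have hB := ramSettingF_bridgeHyps_absLogQPos p e G₁ G₂ h₁ h₂ m (hG₁.trans (isoKE_subset_latticeAuts p e))
    (hG₂.trans (isoKE_subset_latticeAuts p e)) hm
  have hC := iso_pinned_countermodel p e h₁ h₂ m hG₁ hG₂ hm
  ⟨ramFullF_statement p e G₁ G₂ h₁ h₂ m, hB.1, hB.2, hC.2.2.2.1, hC.2.2.2.2.1, hC.2.2.2.2.2.1, hC.2.2.2.2.2.2.1, hC.2.2.2.2.2.2.2.1,
    hC.2.2.2.2.2.2.2.2.1, hC.2.2.2.2.2.2.2.2.2⟩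

include hG₁ hG₂ in
/-- The same against the adjudication's (P″)-shaped derivation `statement_of_thm311_of_pinned3_of_gapH3`: on this bed ALL its typed inputs hold
(Thm 3.11, bridge hypotheses, three pins) and its one open slot `GapH3` is FALSE — so the Statement it would yield is indeed false here.
[claim: Mochizuki2012, status: disputed] -/
theorem isoF_gapH3_is_the_gap (hm : 1 ≤ m) :
    ((ramFullF p e G₁ G₂ h₁ h₂ m).Statement ∧ BridgeHyps (ramSettingF p e G₁ G₂ h₁ h₂ m) ∧
        PinnedRegions3 (ramFullF p e G₁ G₂ h₁ h₂ m).toLatticeSituation (ramSettingF p e G₁ G₂ h₁ h₂ m) (valRegion p e) (qDatumE p e m)) ∧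
      ¬ GapH3 (ramFullF p e G₁ G₂ h₁ h₂ m).toLatticeSituation (ramSettingF p e G₁ G₂ h₁ h₂ m) (valRegion p e) (qDatumE p e m) ∧
      ¬ (ramSettingF p e G₁ G₂ h₁ h₂ m).Statement :=
  have h := isoF_pinned_countermodel p e h₁ h₂ m hG₁ hG₂ hm
  ⟨⟨h.1, h.2.1, h.2.2.2.1⟩, h.2.2.2.2.2.2.2.2.1, h.2.2.2.2.2.2.1⟩

/-- **The maximal isometric reading** (`Gᵢ = isoKE p e`): typed Thm 3.11 ∧ three pins ∧ ¬GapH3 at every `(e, m ≥ 1)`. [claim: Mochizuki2012, status: disputed] -/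
theorem isoKE_full_pinned_countermodel (hm : 1 ≤ m) :
    (ramFullF p e (isoKE p e) (isoKE p e) (refl_mem_isoKE p e) (refl_mem_isoKE p e) m).Statement ∧
      PinnedRegions3 (ramFullF p e (isoKE p e) (isoKE p e) (refl_mem_isoKE p e) (refl_mem_isoKE p e) m).toLatticeSituation
        (ramSettingF p e (isoKE p e) (isoKE p e) (refl_mem_isoKE p e) (refl_mem_isoKE p e) m) (valRegion p e) (qDatumE p e m) ∧
      ¬ GapH3 (ramFullF p e (isoKE p e) (isoKE p e) (refl_mem_isoKE p e) (refl_mem_isoKE p e) m).toLatticeSituation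
        (ramSettingF p e (isoKE p e) (isoKE p e) (refl_mem_isoKE p e) (refl_mem_isoKE p e) m) (valRegion p e) (qDatumE p e m) :=
  have h := isoF_gapH3_is_the_gap p e (refl_mem_isoKE p e) (refl_mem_isoKE p e) m subset_rfl subset_rfl hm
  ⟨h.1.1, h.1.2.2, h.2.1⟩

end Iso

/-! ## 4. The Dupuy–Hilado reading: typed Thm 3.11 holds too, with gen 4's windows and no region reading three-pinning the bed -/

/-- **Under the Dupuy–Hilado reading `Gᵢ = GL(I)` the typed Theorem 3.11 holds as well** — together with gen 4's shallow window (typed Corollary for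
`m ≤ e − 1`) and, for `e ≥ 2`, NO region reading three-pinning the bed (the shear of `CandMochizuki7RamEPins` lies in `GL(I)`): the typed Theorem 3.11
does not separate the two readings of Ism; the Corollary's Θ-pin does. [claim: Mochizuki2012, status: disputed] -/
theorem dhF_typed_windows (he : 2 ≤ e) (h : m + 1 ≤ e) :
    (ramFullF p e (latticeAuts p e) (latticeAuts p e) (refl_mem_latticeAuts p e) (refl_mem_latticeAuts p e) m).Statement ∧
      (ramSettingF p e (latticeAuts p e) (latticeAuts p e) (refl_mem_latticeAuts p e) (refl_mem_latticeAuts p e) m).Statement ∧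
      ∀ ρ qK, ¬ PinnedRegions3
        (ramFullF p e (latticeAuts p e) (latticeAuts p e) (refl_mem_latticeAuts p e) (refl_mem_latticeAuts p e) m).toLatticeSituation
        (ramSettingF p e (latticeAuts p e) (latticeAuts p e) (refl_mem_latticeAuts p e) (refl_mem_latticeAuts p e) m) ρ qK := by
  refine ⟨ramFullF_statement p e _ _ _ _ m, ?_, fun ρ qK hpin => ?_⟩
  · exact ramSettingE_statement_of_le p e m h
  · exact not_thetaPinned_ramE p e he m ρ hpin.1.1

end Summit.ABC.IUTFork.Repair.CandMochizuki7RamE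

end
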